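import Summits.KontsevichZagierPeriods.KontsevichZagierPeriods.Theorems.LinRedNormalFormArrangementNormalFormStubRebaseSimplePosOneFibreCornerOne
import Summits.KontsevichZagierPeriods.KontsevichZagierPeriods.Theorems.LinRedNormalFormArrangementNormalFormStubRebaseSimplePosOneFibreDouble

/-!
# Stub `stub_rebaseSimplePosOneZero` (crux `ArrangementNormalForm`, line `janus-bands`) —
part `OneZeroOfPar`: the stub modulo parallel bands

The registered stub `stub_rebaseSimplePosOneZero` (`GS 1 1 → closure (GG 1 2 1 ∪ JJ 1 2 ∪ JD 2)`
modulo `KZ.relations`: base `(x, y)` in a bounded rational polygon, base factor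
`R(x)/(y − ℓ₂(x))`, one fibre) REDUCED TO PARALLEL BANDS: the B-generic one-fibre rebase
`rebaseSimplePos_oneFibre_of_double'` at `b = 0` needs parallel transverse bands (`Hpar`) and
the double-corner bands (`Hdthick`, `Hdfar`); the latter two are `rebaseSimplePos_dthick_one`,
`rebaseSimplePos_dfar_one` (part `CornerOne`), so the stub follows from `Hpar` at `B = 1` alone
(`rebaseSimplePosOneZero_of_par'`, target embedded by `AddSubgroup.closure_mono`).

References: M. Kontsevich, D. Zagier, *Periods* (2001), §1.2.
-/

noncomputable section

open Set MeasureTheory MvPolynomial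
open Literature.NumberTheory.Transcendental Literature.ModelTheory.ExponentialFields

namespace Summit.KontsevichZagierPeriods.ArrangementNormalForm.JanusBands

/-- **The one-fibre rebase over the base `(x, y)` from parallel bands** (literal data, exponents
`n₁ = 0`, `n₂ = 1`, any bounds, any letter): `rebaseSimplePos_oneFibre_of_double` at `B = 1`
with its double-corner hypotheses discharged by `rebaseSimplePos_dthick_one`,
`rebaseSimplePos_dfar_one`; only parallel transverse bands (`Hpar`, for the base poles `ℓ₂`
and `0`) remain. -/
theorem rebaseSimplePos_oneZero_of_par (m m' : ℕ) (s : KZ.IntegralRep (1 + 1 + 1)) (M : Fin m' → (Fin (1 + 1) → ℚ) × ℚ) (L : Fin m → (Fin 1 → ℚ) × ℚ) (e : Fin m → ℕ) (p : MvPolynomial (Fin 1) ℚ) (ℓ₁ ℓ₂ : (Fin 1 → ℚ) × ℚ) (a : Fin 1 → Option ((Fin (1 + 1) → ℚ) × ℚ)) (lo hi : Fin 1 → Fin 1 ⊕ ((Fin (1 + 1) → ℚ) × ℚ)) (hbd : Bornology.IsBounded s.domain) (hdom : s.domain = SeparatePos.gDom 1 1 m' M lo hi) (hint : EqOn s.integrand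 (RebasePos.glit 1 1 p L e ℓ₁ ℓ₂ 0 1 a) s.domain) (Hpar : ∀ (ℓ : (Fin 1 → ℚ) × ℚ), (ℓ = ℓ₂ ∨ ℓ = 0) → ∀ (m' : ℕ) (s : KZ.IntegralRep (1 + 1 + 1)) (M : Fin m' → (Fin (1 + 1) → ℚ) × ℚ) (p : MvPolynomial (Fin 1) ℚ) (u v : (Fin (1 + 1) → ℚ) × ℚ), Bornology.IsBounded s.domain → s.domain = SeparatePos.gDom 1 1 m' M (fun _ => Sum.inr u) (fun _ => Sum.inr v) → EqOn s.integrand (RebasePos.glit 1 1 p L e ℓ₁ ℓ 0 1 (fun _ => some 0)) s.domain → u.1 (Fin.last 1) ≠ 0 → u.1 (Fin.last 1) = v.1 (Fin.last 1) → (∀ z : Fin (1 + 1 + 1) → ℝ, (∀ j, 0 < SeparatePos.affF 1 1 (M j) z) → 0 < SeparatePos.affF 1 1 u z ∧ SeparatePos.affF 1 1 u z < SeparatePos.affF 1 1 v z) → ∃ c ∈ AddSubgroup.closure (SeparatePos.GGset 1 2 1), KZ.of s - c ∈ KZ.relations) : ∃ c ∈ AddSubgroup.closure (SeparatePos.GGset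 1 2 1), KZ.of s - c ∈ KZ.relations :=
  rebaseSimplePos_oneFibre_of_double 1 m m' s M L e p ℓ₁ ℓ₂ a lo hi hbd hdom hint Hpar
    (fun ℓ _ m' s M p u v κ A => rebaseSimplePos_dthick_one m L e ℓ₁ ℓ m' s M p u v κ A)
    (fun ℓ _ m' s M p u v κ A => rebaseSimplePos_dfar_one m L e ℓ₁ ℓ m' s M p u v κ A)

/-- **The stub `stub_rebaseSimplePosOneZero` from parallel bands at `B = 1`** (exactly its
signature plus `Hpar`, the hypothesis of `rebaseSimplePos_oneFibre_of_double'` at `b = 0` on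
PARALLEL transverse bands): `GS 1 1 → closure (GG 1 2 1 ∪ JJ 1 2 ∪ JD 2)` modulo
`KZ.relations`. The double-corner bands are discharged by `rebaseSimplePos_dthick_one` and
`rebaseSimplePos_dfar_one`. -/
theorem rebaseSimplePosOneZero_of_par' (GS : ℕ → ℕ → Set KZ.FormalRep) (GG : ℕ → ℕ → ℕ → Set KZ.FormalRep) (hGS : ∀ b k, GS b k = {w : KZ.FormalRep | ∃ (m m' n₁ n₂ : ℕ) (s : KZ.IntegralRep (b + 1 + k)) (M : Fin m' → (Fin (b + 1) → ℚ) × ℚ) (L : Fin m → (Fin b → ℚ) × ℚ) (e : Fin m → ℕ) (p : MvPolynomial (Fin b) ℚ) (ℓ₁ ℓ₂ : (Fin b → ℚ) × ℚ) (a : Fin k → Option ((Fin (b + 1) → ℚ) × ℚ)) (lo hi : Fin k → Fin k ⊕ ((Fin (b + 1) → ℚ) × ℚ)), (n₁ = 0 ∨ n₂ = 0) ∧ n₂ = 1 ∧ Bornology.IsBounded s.domain ∧ s.domain = {z | (∀ j, 0 < ∑ i, ((M j).1 i : ℝ) * z (Fin.castAdd k i) + ((M j).2 : ℝ)) ∧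 ∀ i, Sum.elim (fun j => z (Fin.natAdd (b + 1) j)) (fun c => ∑ i', (c.1 i' : ℝ) * z (Fin.castAdd k i') + (c.2 : ℝ)) (lo i) < z (Fin.natAdd (b + 1) i) ∧ z (Fin.natAdd (b + 1) i) < Sum.elim (fun j => z (Fin.natAdd (b + 1) j)) (fun c => ∑ i', (c.1 i' : ℝ) * z (Fin.castAdd k i') + (c.2 : ℝ)) (hi i)} ∧ EqOn s.integrand (fun z => MvPolynomial.aeval (fun i => z (Fin.castAdd k (Fin.castSucc i))) p / (∏ j, (∑ i, ((L j).1 i : ℝ) * z (Fin.castAdd k (Fin.castSucc i)) + ((L j).2 : ℝ)) ^ e j) * ((z (Fin.castAdd k (Fin.last b)) - (∑ i, (ℓ₁.1 i : ℝ) * z (Fin.castAdd k (Fin.castSucc i)) + (ℓ₁.2 : ℝ))) ^ n₁ / (z (Fin.castAdd k (Fin.last b)) - (∑ i, (ℓ₂.1 i : ℝ) * z (Fin.castAdd k (Fin.castSucc i)) + (ℓ₂.2 : ℝ))) ^ n₂) * ∏ i, (a i).elim 1 (fun c => 1 / (z (Fin.natAdd (b + 1) i) - (∑ i', (c.1 i'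 : ℝ) * z (Fin.castAdd k i') + (c.2 : ℝ))))) s.domain ∧ w = KZ.of s}) (hGG : ∀ b σ k, GG b σ k = {w : KZ.FormalRep | ∃ (m m' n₁ n₂ : ℕ) (s : KZ.IntegralRep (b + 1 + k)) (M : Fin m' → (Fin (b + 1) → ℚ) × ℚ) (L : Fin m → (Fin b → ℚ) × ℚ) (e : Fin m → ℕ) (p : MvPolynomial (Fin b) ℚ) (ℓ₁ ℓ₂ : (Fin b → ℚ) × ℚ) (a : Fin k → Option ((Fin (b + 1) → ℚ) × ℚ)) (lo hi : Fin k → Fin k ⊕ ((Fin (b + 1) → ℚ) × ℚ)), (n₁ = 0 ∨ n₂ = 0) ∧ (σ = 2 → (∀ i c, a i = some c → c.1 (Fin.last b) = 0) ∧ (∀ i c, (lo i = Sum.inr c ∨ hi i = Sum.inr c) → (c.1 (Fin.last b) = 0 ∨ c = (Pi.single (Fin.last b) 1, 0)))) ∧ Bornology.IsBounded s.domain ∧ s.domain = {z | (∀ j, 0 < ∑ i, ((M j).1 i : ℝ) * z (Fin.castAdd k i) + ((M j).2 : ℝ)) ∧ ∀ i, Sum.elim (fun j => z (Fin.natAdd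 (b + 1) j)) (fun c => ∑ i', (c.1 i' : ℝ) * z (Fin.castAdd k i') + (c.2 : ℝ)) (lo i) < z (Fin.natAdd (b + 1) i) ∧ z (Fin.natAdd (b + 1) i) < Sum.elim (fun j => z (Fin.natAdd (b + 1) j)) (fun c => ∑ i', (c.1 i' : ℝ) * z (Fin.castAdd k i') + (c.2 : ℝ)) (hi i)} ∧ EqOn s.integrand (fun z => MvPolynomial.aeval (fun i => z (Fin.castAdd k (Fin.castSucc i))) p / (∏ j, (∑ i, ((L j).1 i : ℝ) * z (Fin.castAdd k (Fin.castSucc i)) + ((L j).2 : ℝ)) ^ e j) * ((z (Fin.castAdd k (Fin.last b)) - (∑ i, (ℓ₁.1 i : ℝ) * z (Fin.castAdd k (Fin.castSucc i)) + (ℓ₁.2 : ℝ))) ^ n₁ / (z (Fin.castAdd k (Fin.last b)) - (∑ i, (ℓ₂.1 i : ℝ) * z (Fin.castAdd k (Fin.castSucc i)) + (ℓ₂.2 : ℝ))) ^ n₂) * ∏ i, (a i).elim 1 (fun c => 1 / (z (Fin.natAdd (b + 1) i) - (∑ i', (c.1 i' : ℝ) * z (Fin.castAdd k i') + (c.2 :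 ℝ))))) s.domain ∧ w = KZ.of s}) (JJ : ℕ → ℕ → Set KZ.FormalRep) (JD : ℕ → Set KZ.FormalRep) (hJJ : ∀ b k, JJ b k = {w : KZ.FormalRep | ∃ (m m' : ℕ) (s : KZ.IntegralRep (b + k)) (M : Fin m' → (Fin b → ℚ) × ℚ) (L : Fin m → (Fin b → ℚ) × ℚ) (e : Fin m → ℕ) (p : MvPolynomial (Fin b) ℚ) (a : Fin k → Option ((Fin b → ℚ) × ℚ)) (lo hi : Fin k → Fin k ⊕ ((Fin b → ℚ) × ℚ)), Bornology.IsBounded s.domain ∧ s.domain = {z | (∀ j, 0 < ∑ i, ((M j).1 i : ℝ) * z (Fin.castAdd k i) + ((M j).2 : ℝ)) ∧ ∀ i, Sum.elim (fun j => z (Fin.natAdd b j)) (fun c => ∑ i', (c.1 i' : ℝ) * z (Fin.castAdd k i') + (c.2 : ℝ)) (lo i) < z (Fin.natAdd b i) ∧ z (Fin.natAdd b i) < Sum.elim (fun j => z (Fin.natAdd b j)) (fun c => ∑ i', (c.1 i' : ℝ) * z (Fin.castAdd k i') + (c.2 : ℝ)) (hi i)} ∧ EqOn s.integrand (fun z =>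 MvPolynomial.aeval (fun i => z (Fin.castAdd k i)) p / (∏ j, (∑ i, ((L j).1 i : ℝ) * z (Fin.castAdd k i) + ((L j).2 : ℝ)) ^ e j) * ∏ i, (a i).elim 1 (fun c => 1 / (z (Fin.natAdd b i) - (∑ i', (c.1 i' : ℝ) * z (Fin.castAdd k i') + (c.2 : ℝ))))) s.domain ∧ w = KZ.of s}) (hJD : ∀ N, JD N = {w : KZ.FormalRep | ∃ b' k', b' + k' = N ∧ w ∈ JJ b' k'}) (Hpar : ∀ (m : ℕ) (L : Fin m → (Fin 1 → ℚ) × ℚ) (e : Fin m → ℕ) (ℓ₁ ℓ₂ : (Fin 1 → ℚ) × ℚ), ∀ (m' : ℕ) (s : KZ.IntegralRep (1 + 1 + 1)) (M : Fin m' → (Fin (1 + 1) → ℚ) × ℚ) (p : MvPolynomial (Fin 1) ℚ) (u v : (Fin (1 + 1) → ℚ) × ℚ), Bornology.IsBounded s.domain → s.domain = SeparatePos.gDom 1 1 m' M (fun _ => Sum.inr u) (fun _ => Sum.inr v) → EqOn s.integrand (RebasePos.glit 1 1 p L e ℓ₁ ℓ₂ 0 1 (fun _ => some 0)) s.domain →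 u.1 (Fin.last 1) ≠ 0 → u.1 (Fin.last 1) = v.1 (Fin.last 1) → (∀ z : Fin (1 + 1 + 1) → ℝ, (∀ j, 0 < SeparatePos.affF 1 1 (M j) z) → 0 < SeparatePos.affF 1 1 u z ∧ SeparatePos.affF 1 1 u z < SeparatePos.affF 1 1 v z) → ∃ c ∈ AddSubgroup.closure (SeparatePos.GGset 1 2 1), KZ.of s - c ∈ KZ.relations) : ∀ x ∈ GS 1 1, ∃ c ∈ AddSubgroup.closure (GG 1 2 1 ∪ JJ 1 2 ∪ JD 2), x - c ∈ KZ.relations := by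
  intro x hx
  have _hJJ := hJJ
  have _hJD := hJD
  obtain ⟨c, hc, hxc⟩ := rebaseSimplePos_oneFibre_of_double' GS GG hGS hGG 0 Hpar
    (fun m L e ℓ₁ ℓ₂ m' s M p u v κ A => rebaseSimplePos_dthick_one m L e ℓ₁ ℓ₂ m' s M p u v κ A)
    (fun m L e ℓ₁ ℓ₂ m' s M p u v κ A => rebaseSimplePos_dfar_one m L e ℓ₁ ℓ₂ m' s M p u v κ A) x hx
  exact ⟨c, AddSubgroup.closure_mono (subset_union_left.trans subset_union_left) hc, hxc⟩

end Summit.KontsevichZagierPeriods.ArrangementNormalForm.JanusBands
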